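/-
Copyright (c) 2026 the pub-hodgecm-mathlib formalisation cell (harness21).  Prover seat hodgecm-mathlib-K2E1-p11 (g4), Track B ∕ K2-LIT, h413 = `stmt-HodgeConjecture-24833`,
R90-TF section S8 «ContSpec-n½», #2 road (G side), S8 dealer R90-CS-plan (g3) S8-R151 (1), FILE 3b of the census `R90/S8/CENSUS-ChiSectionPairArchSection.K2E1-p11-g4.md` 3c6bbbb28138e070:
CONTINUITY of the archimedean last-row section `Φa = Θ(ℓ)·ρ_ℓ·χ₂⟨det⟩` on `G_∞` — the place where UNITARITY of `(χ₁, χ₂)` replaces any integral archimedean type: `|Θ| ≤ 1`, so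
`|Θ(ℓ(a))·ρ_ℓ(a)| ≤ ρ_ℓ(a) → 0` at the boundary `{ℓ(a)_w = 0}` of the unit locus, while ON the (open) unit locus `Θ ∘ ℓ` is continuous because the explicit inverse `((ℓ_w⁻¹)_w, 1)` is.
-/
import Summits.HodgeConjecture.HodgeConjecture.Theorems.R90S8ChiSectionPairArchSectionAlgebraU3   -- ★ (this seat) FILE 3a: `lastRowChar_coe_units`, …; brings ★ Defs `idelePhase`, `lastRowChar`, `archLastRow(L)`, `archRowFactor(L)`, `archSection(L)`
import HarnessLib

/-!
# S8 #2 road (G side) — `R90S8ChiSectionPairArchSectionContinuityU3`: the archimedean last-row sections `archSection` (`x₂`) and `archSectionL` (`ℓ = x₂ − x₀`) are CONTINUOUS on `G_∞`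

WHAT THIS FILE DOES.  (§1) `Θ ∘ u` is continuous for every CONTINUOUS IDELE-VALUED map `u` (★ `lastRowChar_coe_units`: `Θ(X) = χ₁((c•X)⁻¹)·χ₂⟨(c•X)X⁻¹⟩`, all three of `χ₁`, `c•`,
`χ₂ ∘ ⟨·⟩` continuous), and `|Θ| ≤ 1` when `χ₁` is unitary and `|χ₂| = 1`.  (§2) THE SQUEEZE LEMMA `continuous_lastRowChar_comp_mul_ofReal`: for a continuous adele-valued `f` with finite part
`1` and a continuous real `ρ` vanishing wherever some archimedean component of `f` vanishes, `x ↦ Θ(f x)·ρ(x)` is continuous — on the open unit locus `{∀ w, (f x)_w ≠ 0}` the idele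
`(f x, ((f x)_w⁻¹)_w ⊕ 1)` depends continuously on `x` (inversion is continuous in each `L_w`, NOT in `𝔸_L` — the finite part is pinned to `1`), and at the boundary `|Θ(f x)·ρ(x)| ≤ |ρ(x)| → 0`.
(§3) The last row of `ι_∞(a)`: continuous entries, finite part `(0,0,1)`, archimedean rows `≠ 0` at every place (`(M M⁻¹)₂₂ = 1`), so `ρ`, `ρ_ℓ` are continuous and vanish exactly where needed;
(§4) **`continuous_archSection`, `continuous_archSectionL`** — the letter `hΦac` of ★ p863433 for both editions.
HONEST LABEL: HC_CM is proved only modulo the 7 printed citations (2 remaining named inputs: hLiu418 = `stmt-HodgeConjecture-24832`, h413 = `stmt-HodgeConjecture-24833`) until rung 0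
closes; REL ≠ ★ ≠ BUILT; this file asserts no named fact and closes no socket; count-neutral.

## References
* [BorelJacquet1979] A. Borel, H. Jacquet, *Automorphic forms and automorphic representations*, Corvallis PSPM 33.1 (1979), §4.1.
* [Rogawski1990] J. D. Rogawski, *Automorphic Representations of Unitary Groups in Three Variables* (1990), §1.10.
-/

set_option autoImplicit false
set_option linter.dupNamespace false  -- the mandated namespace `…HodgeConjecture.HodgeConjecture.R90.S8` (LEAD #1 L1) repeats the summit's segment

noncomputable section

open NumberField IsDedekindDomain Topology Filter
open Literature.NumberTheory.Automorphic Literature.NumberTheory.Automorphic.UnitaryGroup Literature.NumberTheory.GaloisRepresentations AdelicGroupData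
open Literature.NumberTheory.Automorphic.Arthur2013.Leaves.TECR
open Literature.NumberTheory.Automorphic.UnitaryGroup.AdelicCharactersDetQuasiSplit (antidiagonal_over_det_ne_zero)

namespace Summit.HodgeConjecture.HodgeConjecture.R90.S8

variable (L : Type) [Field L] [NumberField L] [IsCMField L]

/-! ## §1 `Θ` along continuous idele-valued maps; `|Θ| ≤ 1` -/

/-- The unit phase `X ↦ ⟨(c•X)·X⁻¹⟩ ∈ U(1)(𝔸_{L⁺})` is continuous on `𝔸_Lˣ`. [cite: Rogawski1990, §1.10] -/
theorem continuous_idelePhase : Continuous (idelePhase L) :=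
  Continuous.subtype_mk
    ((Continuous.units_map (conjAdele (↥(maximalRealSubfield L)) L (IsCMField.complexConj L) : AdeleRing (𝓞 L) L →* AdeleRing (𝓞 L) L)
        (continuous_conjAdele (↥(maximalRealSubfield L)) L (IsCMField.complexConj L))).mul continuous_inv) _

/-- **`Θ ∘ u` is continuous for every continuous idele-valued `u`** (`Θ(X) = χ₁((c•X)⁻¹)·χ₂⟨(c•X)X⁻¹⟩`, ★ `lastRowChar_coe_units`). [cite: Rogawski1990, §1.10] -/
theorem continuous_lastRowChar_units_comp (χ₁ : HeckeCharacter L) (χ₂ : ↥(TorusDict.torus (IsCMField.complexConj L)) →ₜ* ℂˣ)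
    {Y : Type*} [TopologicalSpace Y] {u : Y → (AdeleRing (𝓞 L) L)ˣ} (hu : Continuous u) :
    Continuous fun y => lastRowChar L χ₁ χ₂ ((u y : (AdeleRing (𝓞 L) L)ˣ) : AdeleRing (𝓞 L) L) := by
  simp only [lastRowChar_coe_units]
  have hA : Continuous fun y => ((χ₁ (Units.map (conjAdele (↥(maximalRealSubfield L)) L (IsCMField.complexConj L) : AdeleRing (𝓞 L) L →* AdeleRing (𝓞 L) L) (u y))⁻¹ : ℂˣ) : ℂ) :=
    Units.continuous_val.comp ((map_continuous χ₁).comp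
      (((Continuous.units_map (conjAdele (↥(maximalRealSubfield L)) L (IsCMField.complexConj L) : AdeleRing (𝓞 L) L →* AdeleRing (𝓞 L) L)
        (continuous_conjAdele (↥(maximalRealSubfield L)) L (IsCMField.complexConj L))).comp hu).inv))
  have hB : Continuous fun y => ((adelicOneChar (↥(maximalRealSubfield L)) L (IsCMField.complexConj L) χ₂ (idelePhase L (u y)) : ℂˣ) : ℂ) :=
    Units.continuous_val.comp ((continuous_adelicOneChar (↥(maximalRealSubfield L)) L (IsCMField.complexConj L) χ₂).comp ((continuous_idelePhase L).comp hu))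
  exact hA.mul hB

/-- **`|Θ(x)| ≤ 1`** for unitary `χ₁` and `|χ₂| = 1` (`= 1` on ideles, `= 0` off them). [cite: Rogawski1990, §1.10] -/
theorem norm_lastRowChar_le_one (χ₁ : HeckeCharacter L) (χ₂ : ↥(TorusDict.torus (IsCMField.complexConj L)) →ₜ* ℂˣ)
    (hχ₁u : χ₁.IsUnitary) (hχ₂u : ∀ u, ‖((χ₂ u : ℂˣ) : ℂ)‖ = 1) (x : AdeleRing (𝓞 L) L) : ‖lastRowChar L χ₁ χ₂ x‖ ≤ 1 := by
  by_cases hx : IsUnit x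
  · rw [lastRowChar_of_isUnit L χ₁ χ₂ hx, norm_mul, hχ₁u _, adelicOneChar_apply, hχ₂u _, mul_one]
  · rw [lastRowChar_of_not_isUnit L χ₁ χ₂ hx, norm_zero]
    exact zero_le_one

/-! ## §2 The squeeze lemma -/

omit [IsCMField L] in
/-- An adele `x` with finite part `1` and all archimedean components non-zero is invertible, with the EXPLICIT inverse `y = ((x_w⁻¹)_w, 1)`: `x·y = 1` and `y·x = 1`. [folklore] -/
theorem mul_eq_one_of_fst_inv_of_snd_one (x y : AdeleRing (𝓞 L) L) (h1 : ∀ w : InfinitePlace L, x.1 w ≠ 0) (h2 : x.2 = 1)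
    (hy1 : ∀ w : InfinitePlace L, y.1 w = (x.1 w)⁻¹) (hy2 : y.2 = 1) : x * y = 1 ∧ y * x = 1 := by
  have h : x * y = 1 := by
    refine Prod.ext (funext fun w => ?_) ?_
    · show x.1 w * y.1 w = 1
      rw [hy1 w]
      exact mul_inv_cancel₀ (h1 w)
    · show x.2 * y.2 = 1
      rw [h2, hy2, mul_one]
  exact ⟨h, by rw [mul_comm]; exact h⟩

/-- **THE SQUEEZE LEMMA.**  For unitary `χ₁`, `|χ₂| = 1`, a continuous adele-valued `f` with finite part `1`, and a continuous real `ρ` vanishing wherever some archimedean component of `f`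
vanishes, **`x ↦ Θ(f x)·ρ(x)` is continuous**: on the open unit locus the idele `(f x, ((f x)_w⁻¹)_w ⊕ 1)` is continuous in `x` (§1), at its boundary `|Θ(f x)·ρ(x)| ≤ |ρ(x)| → 0`.
[cite: BorelJacquet1979, §4.1] [cite: Rogawski1990, §1.10] -/
theorem continuous_lastRowChar_comp_mul_ofReal (χ₁ : HeckeCharacter L) (χ₂ : ↥(TorusDict.torus (IsCMField.complexConj L)) →ₜ* ℂˣ)
    (hχ₁u : χ₁.IsUnitary) (hχ₂u : ∀ u, ‖((χ₂ u : ℂˣ) : ℂ)‖ = 1)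
    {X : Type*} [TopologicalSpace X] {f : X → AdeleRing (𝓞 L) L} (hf : Continuous f) (hf2 : ∀ x, (f x).2 = 1)
    {ρ : X → ℝ} (hρ : Continuous ρ) (hρ0 : ∀ x (w : InfinitePlace L), (f x).1 w = 0 → ρ x = 0) :
    Continuous fun x => lastRowChar L χ₁ χ₂ (f x) * (ρ x : ℂ) := by
  refine continuous_iff_continuousAt.2 fun x₀ => ?_
  by_cases h0 : ∀ w : InfinitePlace L, (f x₀).1 w ≠ 0
  · -- on the open unit locus `U`, `Θ ∘ f` is `Θ` along a continuous idele-valued map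
    have hUo : IsOpen {x : X | ∀ w : InfinitePlace L, (f x).1 w ≠ 0} := by
      rw [Set.setOf_forall]
      exact isOpen_iInter_of_finite fun w => isOpen_ne_fun ((continuous_apply w).comp (continuous_fst.comp hf)) continuous_const
    have hval : Continuous fun x : {x : X | ∀ w : InfinitePlace L, (f x).1 w ≠ 0} => f x.1 := hf.comp continuous_subtype_val
    have hinv : Continuous fun x : {x : X | ∀ w : InfinitePlace L, (f x).1 w ≠ 0} =>
        (fun w : InfinitePlace L => ((f x.1).1 w)⁻¹, (1 : FiniteAdeleRing (𝓞 L) L)) :=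
      (continuous_pi fun w => ((continuous_apply w).comp (continuous_fst.comp hval)).inv₀ fun x => x.2 w).prodMk continuous_const
    have hu : Continuous fun x : {x : X | ∀ w : InfinitePlace L, (f x).1 w ≠ 0} =>
        (⟨f x.1, (fun w : InfinitePlace L => ((f x.1).1 w)⁻¹, (1 : FiniteAdeleRing (𝓞 L) L)),
          (mul_eq_one_of_fst_inv_of_snd_one L (f x.1) (fun w : InfinitePlace L => ((f x.1).1 w)⁻¹, (1 : FiniteAdeleRing (𝓞 L) L)) x.2 (hf2 x.1)
            (fun _ => rfl) rfl).1,
          (mul_eq_one_of_fst_inv_of_snd_one L (f x.1) (fun w : InfinitePlace L => ((f x.1).1 w)⁻¹, (1 : FiniteAdeleRing (𝓞 L) L)) x.2 (hf2 x.1)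
            (fun _ => rfl) rfl).2⟩ : (AdeleRing (𝓞 L) L)ˣ) :=
      Units.continuous_iff.2 ⟨hval, hinv⟩
    have hΘ : ContinuousOn (fun x => lastRowChar L χ₁ χ₂ (f x)) {x : X | ∀ w : InfinitePlace L, (f x).1 w ≠ 0} := by
      rw [continuousOn_iff_continuous_restrict]
      exact continuous_lastRowChar_units_comp L χ₁ χ₂ hu
    exact (hΘ.continuousAt (hUo.mem_nhds h0)).mul (Complex.continuous_ofReal.comp hρ).continuousAt
  · -- at the boundary: `|Θ(f x)·ρ(x)| ≤ |ρ(x)| → |ρ(x₀)| = 0`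
    push Not at h0
    obtain ⟨w, hw⟩ := h0
    have hx₀ : lastRowChar L χ₁ χ₂ (f x₀) * (ρ x₀ : ℂ) = 0 := by
      rw [hρ0 x₀ w hw, Complex.ofReal_zero, mul_zero]
    change Tendsto (fun x => lastRowChar L χ₁ χ₂ (f x) * (ρ x : ℂ)) (𝓝 x₀) (𝓝 (lastRowChar L χ₁ χ₂ (f x₀) * (ρ x₀ : ℂ)))
    rw [hx₀]
    refine squeeze_zero_norm (a := fun x => ‖ρ x‖) (fun x => ?_) ?_
    · rw [norm_mul, Complex.norm_real]
      exact mul_le_of_le_one_left (norm_nonneg _) (norm_lastRowChar_le_one L χ₁ χ₂ hχ₁u hχ₂u _)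
    · have h := (hρ.norm).tendsto x₀
      rwa [hρ0 x₀ w hw, norm_zero] at h

/-! ## §3 The last row of `ι_∞(a)`: continuity, finite part, non-vanishing per place -/

/-- The entries of the last row of `ι_∞(a)` depend continuously on `a ∈ G_∞`. [cite: BorelJacquet1979, §4.1] -/
theorem continuous_archLastRow (j : Fin 3) :
    Continuous fun a : arch (↥(maximalRealSubfield L)) L (IsCMField.complexConj L) 3 ((StdForm.antidiagonal 3).over L) => archLastRow L a j :=
  ((Units.continuous_val.comp ((GLn.continuous_ofInfinite 3 L).comp continuous_subtype_val)).matrix_elem 2 j).congr fun _ => rfl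

/-- The archimedean components of the last-row entries are continuous. [cite: BorelJacquet1979, §4.1] -/
theorem continuous_archLastRow_fst_apply (j : Fin 3) (w : InfinitePlace L) :
    Continuous fun a : arch (↥(maximalRealSubfield L)) L (IsCMField.complexConj L) 3 ((StdForm.antidiagonal 3).over L) => (archLastRow L a j).1 w :=
  (continuous_apply w).comp (continuous_fst.comp (continuous_archLastRow L j))

/-- The finite part of the last row of `ι_∞(a) = (a, 1)` is `(0, 0, 1)`. [cite: BorelJacquet1979, §4.1] -/
theorem archLastRow_snd (a : arch (↥(maximalRealSubfield L)) L (IsCMField.complexConj L) 3 ((StdForm.antidiagonal 3).over L)) (j : Fin 3) :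
    (archLastRow L a j).2 = (1 : Matrix (Fin 3) (Fin 3) (FiniteAdeleRing (𝓞 L) L)) 2 j := by
  rw [archLastRow_def, adelicVal_archToAdelic, GLn.coe_ofInfinite_apply]

/-- The finite part of `x₂(a)` is `1`. [cite: BorelJacquet1979, §4.1] -/
theorem archLastRow_two_snd (a : arch (↥(maximalRealSubfield L)) L (IsCMField.complexConj L) 3 ((StdForm.antidiagonal 3).over L)) :
    (archLastRow L a 2).2 = 1 := by
  rw [archLastRow_snd, Matrix.one_apply_eq]

/-- `ℓ = x₂ − x₀` is continuous on `G_∞`. [cite: BorelJacquet1979, §4.1] -/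
theorem continuous_archLastRowL : Continuous (archLastRowL L) :=
  ((continuous_archLastRow L 2).sub (continuous_archLastRow L 0)).congr fun _ => rfl

/-- The finite part of `ℓ(a) = x₂ − x₀` is `1 − 0 = 1`. [cite: BorelJacquet1979, §4.1] -/
theorem archLastRowL_snd (a : arch (↥(maximalRealSubfield L)) L (IsCMField.complexConj L) 3 ((StdForm.antidiagonal 3).over L)) :
    (archLastRowL L a).2 = 1 := by
  change (archLastRow L a 2).2 - (archLastRow L a 0).2 = 1
  rw [archLastRow_snd, archLastRow_snd, Matrix.one_apply_eq, Matrix.one_apply_ne (by decide), sub_zero]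

/-- **At every archimedean place the last row of `a_w` is non-zero** (`Σⱼ (a_w)₂ⱼ (a_w⁻¹)ⱼ₂ = 1`). [cite: BorelJacquet1979, §4.1] -/
theorem archLastRow_fst_ne_zero (a : arch (↥(maximalRealSubfield L)) L (IsCMField.complexConj L) 3 ((StdForm.antidiagonal 3).over L)) (w : InfinitePlace L) :
    (fun j : Fin 3 => (archLastRow L a j).1 w) ≠ 0 := by
  intro h
  set g := adelicVal (↥(maximalRealSubfield L)) L (IsCMField.complexConj L) 3 ((StdForm.antidiagonal 3).over L)
    (archToAdelic (↥(maximalRealSubfield L)) L (IsCMField.complexConj L) 3 ((StdForm.antidiagonal 3).over L) a) with hg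
  let π : AdeleRing (𝓞 L) L →+* w.Completion := (Pi.evalRingHom (fun v : InfinitePlace L => v.Completion) w).comp (adeleFst L)
  have h0 : ∀ j : Fin 3, π ((g : Matrix (Fin 3) (Fin 3) (AdeleRing (𝓞 L) L)) 2 j) = 0 := fun j => congrFun h j
  have h1 : ∑ j : Fin 3, (g : Matrix (Fin 3) (Fin 3) (AdeleRing (𝓞 L) L)) 2 j * ((g⁻¹ : GL (Fin 3) (AdeleRing (𝓞 L) L)) : Matrix (Fin 3) (Fin 3) (AdeleRing (𝓞 L) L)) j 2 = 1 := by
    rw [← Matrix.mul_apply, Units.mul_inv, Matrix.one_apply_eq]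
  have h2 := congrArg π h1
  rw [map_sum, map_one] at h2
  simp only [map_mul, h0, zero_mul, Finset.sum_const_zero] at h2
  exact zero_ne_one h2

/-- Hence `‖((x₀)_w, (x₁)_w, (x₂)_w)‖ ≠ 0`. [cite: BorelJacquet1979, §4.1] -/
theorem norm_archLastRow_fst_ne_zero (a : arch (↥(maximalRealSubfield L)) L (IsCMField.complexConj L) 3 ((StdForm.antidiagonal 3).over L)) (w : InfinitePlace L) :
    ‖fun j : Fin 3 => (archLastRow L a j).1 w‖ ≠ 0 :=
  norm_ne_zero_iff.2 (archLastRow_fst_ne_zero L a w)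

/-- The row norms `a ↦ ‖((x₀)_w, (x₁)_w, (x₂)_w)‖` are continuous. [cite: BorelJacquet1979, §4.1] -/
theorem continuous_norm_archLastRow_fst (w : InfinitePlace L) :
    Continuous fun a : arch (↥(maximalRealSubfield L)) L (IsCMField.complexConj L) 3 ((StdForm.antidiagonal 3).over L) => ‖fun j : Fin 3 => (archLastRow L a j).1 w‖ :=
  (continuous_pi fun j => continuous_archLastRow_fst_apply L j w).norm

/-- **`ρ` is continuous.** [cite: BorelJacquet1979, §4.1] -/
theorem continuous_archRowFactor : Continuous (archRowFactor L) := by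
  show Continuous fun a => ∏ w : InfinitePlace L, ‖(archLastRow L a 2).1 w‖ / ‖fun j : Fin 3 => (archLastRow L a j).1 w‖
  exact continuous_finsetProd _ fun w _ =>
    ((continuous_archLastRow_fst_apply L 2 w).norm).div (continuous_norm_archLastRow_fst L w) fun a => norm_archLastRow_fst_ne_zero L a w

/-- **`ρ_ℓ` is continuous.** [cite: BorelJacquet1979, §4.1] -/
theorem continuous_archRowFactorL : Continuous (archRowFactorL L) := by
  show Continuous fun a => ∏ w : InfinitePlace L, ‖(archLastRowL L a).1 w‖ / ‖fun j : Fin 3 => (archLastRow L a j).1 w‖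
  exact continuous_finsetProd _ fun w _ =>
    (((continuous_apply w).comp (continuous_fst.comp (continuous_archLastRowL L))).norm).div (continuous_norm_archLastRow_fst L w)
      fun a => norm_archLastRow_fst_ne_zero L a w

/-- `ρ(a) = 0` as soon as one archimedean component of `x₂(a)` vanishes. [cite: BorelJacquet1979, §4.1] -/
theorem archRowFactor_eq_zero_of_fst_eq_zero (a : arch (↥(maximalRealSubfield L)) L (IsCMField.complexConj L) 3 ((StdForm.antidiagonal 3).over L)) (w : InfinitePlace L)
    (hw : (archLastRow L a 2).1 w = 0) : archRowFactor L a = 0 :=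
  Finset.prod_eq_zero (Finset.mem_univ w) (by rw [hw, norm_zero, zero_div])

/-- `ρ_ℓ(a) = 0` as soon as one archimedean component of `ℓ(a)` vanishes. [cite: BorelJacquet1979, §4.1] -/
theorem archRowFactorL_eq_zero_of_fst_eq_zero (a : arch (↥(maximalRealSubfield L)) L (IsCMField.complexConj L) 3 ((StdForm.antidiagonal 3).over L)) (w : InfinitePlace L)
    (hw : (archLastRowL L a).1 w = 0) : archRowFactorL L a = 0 :=
  Finset.prod_eq_zero (Finset.mem_univ w) (by rw [hw, norm_zero, zero_div])

/-- The determinant character `a ↦ χ₂⟨det ι_∞(a)⟩` is continuous. [cite: BorelJacquet1979, §4.1] -/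
theorem continuous_adelicOneChar_adelicDet_archToAdelic (χ₂ : ↥(TorusDict.torus (IsCMField.complexConj L)) →ₜ* ℂˣ) :
    Continuous fun a : arch (↥(maximalRealSubfield L)) L (IsCMField.complexConj L) 3 ((StdForm.antidiagonal 3).over L) =>
      ((adelicOneChar (↥(maximalRealSubfield L)) L (IsCMField.complexConj L) χ₂
        (adelicDet (↥(maximalRealSubfield L)) L (IsCMField.complexConj L) 3 ((StdForm.antidiagonal 3).over L) (antidiagonal_over_det_ne_zero L 3)
          (archToAdelic (↥(maximalRealSubfield L)) L (IsCMField.complexConj L) 3 ((StdForm.antidiagonal 3).over L) a)) : ℂˣ) : ℂ) :=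
  Units.continuous_val.comp ((continuous_adelicOneChar (↥(maximalRealSubfield L)) L (IsCMField.complexConj L) χ₂).comp
    ((continuous_adelicDet (F := ↥(maximalRealSubfield L)) (E := L) (c := IsCMField.complexConj L) (N := 3) (J := (StdForm.antidiagonal 3).over L)
      (hJ := antidiagonal_over_det_ne_zero L 3)).comp
      (continuous_archToAdelic (↥(maximalRealSubfield L)) L (IsCMField.complexConj L) 3 ((StdForm.antidiagonal 3).over L))))

/-! ## §4 Continuity of the sections -/

/-- **`Φa = Θ(x₂)·ρ·χ₂⟨det⟩` IS CONTINUOUS on `G_∞`** for unitary `χ₁` and `|χ₂| = 1` — the letter `hΦac` of ★ p863433 for the first edition. [cite: BorelJacquet1979, §4.1] [cite: Rogawski1990, §1.10] -/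
theorem continuous_archSection (χ₁ : HeckeCharacter L) (χ₂ : ↥(TorusDict.torus (IsCMField.complexConj L)) →ₜ* ℂˣ)
    (hχ₁u : χ₁.IsUnitary) (hχ₂u : ∀ u, ‖((χ₂ u : ℂˣ) : ℂ)‖ = 1) : Continuous (archSection L χ₁ χ₂) :=
  ((continuous_lastRowChar_comp_mul_ofReal L χ₁ χ₂ hχ₁u hχ₂u (continuous_archLastRow L 2) (archLastRow_two_snd L) (continuous_archRowFactor L)
      (fun a w hw => archRowFactor_eq_zero_of_fst_eq_zero L a w hw)).mul (continuous_adelicOneChar_adelicDet_archToAdelic L χ₂)).congr fun _ => rfl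

/-- **`Φa = Θ(ℓ)·ρ_ℓ·χ₂⟨det⟩` IS CONTINUOUS on `G_∞`** for unitary `χ₁` and `|χ₂| = 1` — the letter `hΦac` of ★ p863433 for the `ℓ`-edition (ED.2). [cite: BorelJacquet1979, §4.1]
[cite: Rogawski1990, §1.10] -/
theorem continuous_archSectionL (χ₁ : HeckeCharacter L) (χ₂ : ↥(TorusDict.torus (IsCMField.complexConj L)) →ₜ* ℂˣ)
    (hχ₁u : χ₁.IsUnitary) (hχ₂u : ∀ u, ‖((χ₂ u : ℂˣ) : ℂ)‖ = 1) : Continuous (archSectionL L χ₁ χ₂) :=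
  ((continuous_lastRowChar_comp_mul_ofReal L χ₁ χ₂ hχ₁u hχ₂u (continuous_archLastRowL L) (archLastRowL_snd L) (continuous_archRowFactorL L)
      (fun a w hw => archRowFactorL_eq_zero_of_fst_eq_zero L a w hw)).mul (continuous_adelicOneChar_adelicDet_archToAdelic L χ₂)).congr fun _ => rfl

end Summit.HodgeConjecture.HodgeConjecture.R90.S8

end
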